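import Literature.MathematicalPhysics.KineticTheory.SiteChainLaSalle
import HarnessLib

/-!
# Site-inhomogeneous confining chains: LaSalle relaxation, irreducibility towards the equilibrium, uniqueness of the invariant measure from one local minorisation

Topic `Literature/MathematicalPhysics/KineticTheory`, grouping namespace `…KineticTheory.HeatConduction`.
Continuation of `SiteChainLaSalle.lean`; twin, for the site-dependent chains `SiteChain` under
`SiteChain.UniformlyConfining`, of the second half of `LangevinChainConfinedLaSalle.lean`. For a
uniformly confining chain with POSITIVE friction, SITEWISE INJECTIVE bond forces `V_i'` and a potential
whose ONLY CRITICAL POINT is the origin (e.g. every cell chain `cellChain ω₂ lam β γ c`, `ω₂ > 0`,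
`lam, β ≥ 0`: `V_i' = r + β_i r³`, `∑_i q_i ∂_iΦ(q) ≥ ω₂|q|²`):

* sitewise force calculus: the closed form `∂_iΦ = U_i'(q_i) + [0 < i] V_{i-1}'(q_i - q_{i-1}) -
  [i+1 < N] V_i'(q_{i+1} - q_i)` (`SiteChain.dPotential_eq_closed`, `dPotential_succ_eq`) and the
  virial identity `∑_i q_i ∂_iΦ(q) = ∑_i q_i U_i'(q_i) + ∑_{bonds} V_k'(Δ) Δ` (`sum_mul_dPotential`);
* **rigidity** (`UniformlyConfining.eq_zero_of_momentum_last_eq_zero`): if along the undriven flow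
  started at `w` the momentum of the last site vanishes identically then `w = 0` (peeling from the
  right through the component equations);
* **LaSalle** (`UniformlyConfining.tendsto_freeFlow_zero`): every undriven trajectory converges to `0`;
* **pointed irreducibility** (`UniformlyConfining.langevinKernel_pos_of_mem_nhds_zero`): every
  neighbourhood of `0` is reached from every point with positive probability at all large times
  (model-free `ConfinedDrift.sdeKernel_pos_of_tendsto_flow`);
* **uniqueness from one local minorisation** (`UniformlyConfining.invariant_unique_of_localSmall`):
  one local small set near the equilibrium makes every compact set small (Feller + irreducibility,
  `MarkovSemigroup.exists_smul_le_of_isCompact_of_mem`), the sublevel sets `{H ≤ n}` exhaust phase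
  space, and `invariant_unique_of_small_cover` leaves AT MOST ONE probability measure invariant under
  all the Langevin kernels `P.langevinKernel N T_L T_R t`.

## References

* J. P. LaSalle, *Some extensions of Liapunov's second method*, IRE Trans. Circuit Theory **7**
  (1960) 520–527.
* N. Cuneo, J.-P. Eckmann, M. Hairer, L. Rey-Bellet, *Non-equilibrium steady states for networks of
  oscillators*, Electron. J. Probab. **23** (2018) no. 55, Props. 3.3, 3.6, 3.8.
* S. P. Meyn, R. L. Tweedie, *Markov Chains and Stochastic Stability* (1993), Thm 10.0.1.

## Design choices

* Proofs are those of `LangevinChainConfinedLaSalle.lean` / `LangevinChainLaSalle.lean` /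
  `LangevinChainScalingLimit.lean` (`dPotential_eq_closed`) with sitewise data; the hypotheses of
  rigidity are sitewise (`∀ i, Injective (deriv (P.V i))`).
* The uniqueness statement takes invariance in the raw form `∀ t, Kernel.Invariant (P.langevinKernel
  N T_L T_R t) μ` (no sign condition on the temperatures is needed for this direction).
-/

noncomputable section

open MeasureTheory ProbabilityTheory Filter Topology Set Metric
open scoped NNReal ENNReal ContDiff

namespace Literature.MathematicalPhysics.KineticTheory.HeatConduction

open Literature.MathematicalPhysics.KineticTheory Literature.Probability.Process Literature.Analysis.ODE

variable {N : ℕ}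

namespace SiteChain

variable (P : SiteChain)

/-! ### Sitewise force calculus -/

/-- **Closed form of the sitewise force component**:
`∂Φ/∂q_i = U_i'(q_i) + [0 < i] V_{i-1}'(q_i - q_{i-1}) - [i+1 < N] V_i'(q_{i+1} - q_i)`
(evaluation of the double sum over bonds in `SiteChain.dPotential`). [folklore] -/
theorem dPotential_eq_closed (N : ℕ) (i : Fin N) (q : Fin N → ℝ) :
    P.dPotential N i q = deriv (P.U i.val) (q i) +
      (if h : 0 < i.val then deriv (P.V (i.val - 1)) (q i - q ⟨i.val - 1, by omega⟩) else 0) -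
      (if h : i.val + 1 < N then deriv (P.V i.val) (q ⟨i.val + 1, h⟩ - q i) else 0) := by
  unfold SiteChain.dPotential
  rw [add_sub_assoc]
  congr 1
  -- split the double sum into the `[l = i]` part and the `[k = i]` part
  have hsplit : ∀ k l : Fin N, (if l.val = k.val + 1 then
      deriv (P.V k.val) (q l - q k) * ((if l = i then 1 else 0) - (if k = i then 1 else 0)) else (0 : ℝ)) =
      (if l.val = k.val + 1 ∧ l = i then deriv (P.V k.val) (q l - q k) else 0) -
        (if l.val = k.val + 1 ∧ k = i then deriv (P.V k.val) (q l - q k) else 0) := by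
    intro k l
    by_cases h1 : l.val = k.val + 1
    · by_cases h2 : l = i
      · have h3 : k ≠ i := by
          intro h3; rw [h2, h3] at h1; omega
        simp [h2, h3]
      · by_cases h3 : k = i
        · simp [h1, h2, h3]
        · simp [h1, h2, h3]
    · simp [h1]
  simp_rw [hsplit, Finset.sum_sub_distrib]
  congr 1
  · -- `∑_k ∑_l [l = k+1 ∧ l = i] f(k,l) = [0 < i] f(i-1, i)`
    rw [Finset.sum_comm]
    rw [Finset.sum_eq_single i (fun l _ hl => by simp [hl]) (by simp)]
    by_cases hi : 0 < i.val
    · rw [dif_pos hi]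
      rw [Finset.sum_eq_single (⟨i.val - 1, by omega⟩ : Fin N)]
      · rw [if_pos ⟨by show i.val = (i.val - 1) + 1; omega, rfl⟩]
      · intro k _ hk
        rw [if_neg]
        rintro ⟨h1, -⟩
        apply hk
        ext; simp only; omega
      · simp
    · rw [dif_neg hi]
      refine Finset.sum_eq_zero fun k _ => ?_
      rw [if_neg]
      rintro ⟨h1, -⟩
      omega
  · -- `∑_k ∑_l [l = k+1 ∧ k = i] f(k,l) = [i+1 < N] f(i, i+1)`
    rw [Finset.sum_eq_single i (fun k _ hk => by simp [hk]) (by simp)]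
    by_cases hi : i.val + 1 < N
    · rw [dif_pos hi]
      rw [Finset.sum_eq_single (⟨i.val + 1, hi⟩ : Fin N)]
      · simp
      · intro l _ hl
        rw [if_neg]
        rintro ⟨h1, -⟩
        apply hl
        ext; simp only; omega
      · simp
    · rw [dif_neg hi]
      refine Finset.sum_eq_zero fun l _ => ?_
      rw [if_neg]
      rintro ⟨h1, -⟩
      omega

/-- The sitewise force at a site `i + 1` in closed form:
`∂_{i+1}Φ(q) = U_{i+1}'(q_{i+1}) + V_i'(q_{i+1} - q_i) - [i+2 < N] V_{i+1}'(q_{i+2} - q_{i+1})`.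
[folklore] -/
theorem dPotential_succ_eq (N : ℕ) (i : Fin N) (hi : i.val + 1 < N) (q : Fin N → ℝ) :
    P.dPotential N ⟨i.val + 1, hi⟩ q =
      deriv (P.U (i.val + 1)) (q ⟨i.val + 1, hi⟩) + deriv (P.V i.val) (q ⟨i.val + 1, hi⟩ - q i) -
        (if h : i.val + 1 + 1 < N then
          deriv (P.V (i.val + 1)) (q ⟨i.val + 1 + 1, h⟩ - q ⟨i.val + 1, hi⟩) else 0) := by
  rw [P.dPotential_eq_closed]
  have h1 : (0 : ℕ) < (⟨i.val + 1, hi⟩ : Fin N).val := Nat.succ_pos _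
  rw [dif_pos h1]
  simp only [Nat.add_sub_cancel]

/-- **Virial identity for the sitewise force**:
`∑_i q_i ∂_iΦ(q) = ∑_i q_i U_i'(q_i) + ∑_{l = k+1} V_k'(q_l - q_k) (q_l - q_k)` (the bond terms of
`SiteChain.dPotential` regroup by action–reaction). [folklore] -/
theorem sum_mul_dPotential (N : ℕ) (q : Fin N → ℝ) :
    ∑ i, q i * P.dPotential N i q =
      ∑ i, q i * deriv (P.U i.val) (q i) +
        ∑ k : Fin N, ∑ l : Fin N,
          if l.val = k.val + 1 then deriv (P.V k.val) (q l - q k) * (q l - q k) else 0 := by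
  simp only [SiteChain.dPotential, mul_add, Finset.sum_add_distrib]
  congr 1
  have h1 : ∀ i : Fin N, q i * ∑ k : Fin N, ∑ l : Fin N, (if l.val = k.val + 1 then
      deriv (P.V k.val) (q l - q k) * ((if l = i then 1 else 0) - (if k = i then 1 else 0)) else 0) =
      ∑ k : Fin N, ∑ l : Fin N, (if l.val = k.val + 1 then
        deriv (P.V k.val) (q l - q k) * (q i * ((if l = i then 1 else 0) - (if k = i then 1 else 0)))
        else 0) := by
    intro i
    rw [Finset.mul_sum]
    refine Finset.sum_congr rfl fun k _ => ?_
    rw [Finset.mul_sum]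
    refine Finset.sum_congr rfl fun l _ => ?_
    split_ifs <;> ring
  simp_rw [h1]
  rw [Finset.sum_comm]
  refine Finset.sum_congr rfl fun k _ => ?_
  rw [Finset.sum_comm]
  refine Finset.sum_congr rfl fun l _ => ?_
  by_cases h : l.val = k.val + 1
  · simp only [h, if_true]
    rw [← Finset.mul_sum]
    congr 1
    simp [mul_sub, Finset.sum_sub_distrib, mul_ite, Finset.sum_ite_eq]
  · simp [h]

namespace UniformlyConfining

variable {P}

/-! ### Rigidity: a motionless right end freezes the whole chain at the origin -/

/-- **Rigidity** for a uniformly confining site-dependent chain with sitewise injective bond forces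
`V_i'` whose potential has the origin as its only critical point: if along the undriven flow
started at `w` the momentum of the last site vanishes for all times, then `w = 0` (`N ≥ 1`).
Peeling from the right: every site `i ≥ N - k` has `p_i ≡ 0` (so `q_i` is frozen); the vanishing
force at site `i+1` pins `V_i'(q_{i+1} - q_i(t))` to a constant, so `q_i` is frozen (`V_i'`
injective) and `p_i = q̇_i ≡ 0`; at the end `w` is a critical point of `Φ` with `p = 0`.
[cite: CuneoEckmannHairerReyBellet2018, Prop 3.3] -/
theorem eq_zero_of_momentum_last_eq_zero (hP : P.UniformlyConfining) (N : ℕ) (hN : 0 < N)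
    (hVinj : ∀ i, Function.Injective (deriv (P.V i)))
    (hcrit : ∀ q : Fin N → ℝ, (∀ i, P.dPotential N i q = 0) → q = 0) (w : PhaseSpace N)
    (h : ∀ t, 0 ≤ t → (drivenFlow (P.langevinDrift N) w 0 t).2 ⟨N - 1, by omega⟩ = 0) :
    w = 0 := by
  have hzc : Continuous (drivenFlow (P.langevinDrift N) w 0) := hP.continuous_freeFlow N w
  have hz0 : drivenFlow (P.langevinDrift N) w 0 0 = w := hP.freeFlow_zero N w
  -- peeling induction on the number `k` of frozen sites from the right
  have hpeel : ∀ k, k ≤ N → ∀ i : Fin N, N - k ≤ i.val →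
      ∀ t, 0 ≤ t → (drivenFlow (P.langevinDrift N) w 0 t).2 i = 0 := by
    intro k
    induction k with
    | zero =>
      intro _ i hi
      exact absurd i.isLt (by omega)
    | succ k ih =>
      intro hk i hi
      by_cases hi' : N - k ≤ i.val
      · exact ih (by omega) i hi'
      · have hieq : i.val = N - (k + 1) := by omega
        rcases Nat.eq_zero_or_pos k with hk0 | hkpos
        · subst hk0
          have hiN : i = ⟨N - 1, by omega⟩ := Fin.ext (by simpa using hieq)
          intro t ht
          rw [hiN]
          exact h t ht
        · have hi₁ : i.val + 1 < N := by omega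
          have hp₁ : ∀ t, 0 ≤ t → (drivenFlow (P.langevinDrift N) w 0 t).2 ⟨i.val + 1, hi₁⟩ = 0 :=
            ih (by omega) ⟨i.val + 1, hi₁⟩ (by simp only; omega)
          have hq₁ := hP.freeFlow_fst_const_of_snd_eq_zero N w ⟨i.val + 1, hi₁⟩ hp₁
          have hF₁ := hP.dPotential_eq_zero_of_snd_eq_zero N w ⟨i.val + 1, hi₁⟩ hp₁
          have hq₂ : ∀ (h2 : i.val + 1 + 1 < N) (t : ℝ), 0 ≤ t →
              (drivenFlow (P.langevinDrift N) w 0 t).1 ⟨i.val + 1 + 1, h2⟩ = w.1 ⟨i.val + 1 + 1, h2⟩ :=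
            fun h2 => hP.freeFlow_fst_const_of_snd_eq_zero N w ⟨i.val + 1 + 1, h2⟩
              (ih (by omega) ⟨i.val + 1 + 1, h2⟩ (by simp only; omega))
          -- the interaction force on the bond `(i, i+1)` is frozen
          have hV : ∀ t, 0 ≤ t →
              deriv (P.V i.val) (w.1 ⟨i.val + 1, hi₁⟩ - (drivenFlow (P.langevinDrift N) w 0 t).1 i) =
                -deriv (P.U (i.val + 1)) (w.1 ⟨i.val + 1, hi₁⟩) +
                  (if h2 : i.val + 1 + 1 < N then
                    deriv (P.V (i.val + 1)) (w.1 ⟨i.val + 1 + 1, h2⟩ - w.1 ⟨i.val + 1, hi₁⟩) else 0) := by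
            intro t ht
            have e := hF₁ t ht
            rw [P.dPotential_succ_eq N i hi₁, hq₁ t ht] at e
            by_cases h2 : i.val + 1 + 1 < N
            · rw [dif_pos h2, hq₂ h2 t ht] at e
              rw [dif_pos h2]
              linarith
            · rw [dif_neg h2] at e
              rw [dif_neg h2]
              linarith
          -- hence `q_i` is frozen
          have hqi : ∀ t, 0 ≤ t → (drivenFlow (P.langevinDrift N) w 0 t).1 i = w.1 i := by
            intro t ht
            have e1 := hV t ht
            have e0 := hV 0 le_rfl
            rw [hz0] at e0
            have e2 := hVinj i.val (e1.trans e0.symm)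
            linarith
          -- hence `p_i ≡ 0`
          have hpc : Continuous fun s => (drivenFlow (P.langevinDrift N) w 0 s).2 i :=
            (continuous_apply i).comp (continuous_snd.comp hzc)
          refine eq_zero_of_intervalIntegral_eq_zero hpc fun t ht => ?_
          have e := hP.freeFlow_fst_eq N w i ht
          rw [hqi t ht] at e
          linarith
  have hall : ∀ i : Fin N, ∀ t, 0 ≤ t → (drivenFlow (P.langevinDrift N) w 0 t).2 i = 0 :=
    fun i => hpeel N le_rfl i (by omega)
  have hp0 : w.2 = 0 := by
    funext i
    have := hall i 0 le_rfl
    rwa [hz0] at this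
  have hq0 : w.1 = 0 := by
    refine hcrit w.1 fun i => ?_
    have := hP.dPotential_eq_zero_of_snd_eq_zero N w i (hall i) 0 le_rfl
    rwa [hz0] at this
  exact Prod.ext hq0 hp0

/-! ### LaSalle: the undriven chain relaxes to the origin -/

/-- **LaSalle's invariance principle for a damped uniformly confining site-dependent chain**
(`γ > 0`, `N ≥ 1`, all `V_i'` injective, `0` the only critical point of the potential): every
trajectory of the undriven chain converges to the equilibrium `0`. The orbit lies in the compact set
`{H ≤ H(x)}`; at a cluster point `w ≠ 0` the energy would be stationary along `φ(w)`, so the momentum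
of the last (bath) site would vanish identically, so `w = 0` by rigidity.
[cite: CuneoEckmannHairerReyBellet2018, Prop 3.3] -/
theorem tendsto_freeFlow_zero (hP : P.UniformlyConfining) (N : ℕ) (hγ : 0 < P.γ) (hN : 0 < N)
    (hVinj : ∀ i, Function.Injective (deriv (P.V i)))
    (hcrit : ∀ q : Fin N → ℝ, (∀ i, P.dPotential N i q = 0) → q = 0) (x : PhaseSpace N) :
    Tendsto (drivenFlow (P.langevinDrift N) x 0) atTop (𝓝 0) := by
  by_contra hnot
  obtain ⟨U, hU, hfreq⟩ := not_tendsto_iff_exists_frequently_notMem.1 hnot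
  obtain ⟨V, hVU, hVopen, h0V⟩ := _root_.mem_nhds_iff.1 hU
  set K : Set (PhaseSpace N) := {y | P.hamiltonian N y ≤ P.hamiltonian N x} ∩ Vᶜ with hK
  have hKc : IsCompact K := (hP.isCompact_setOf_hamiltonian_le N _).inter_right hVopen.isClosed_compl
  have hfreqK : ∃ᶠ t in atTop, drivenFlow (P.langevinDrift N) x 0 t ∈ K := by
    refine (hfreq.and_eventually (Eventually.of_forall fun t =>
      hP.freeFlow_mem_sublevel N x t)).mono fun t ht => ?_
    exact ⟨ht.2, fun hV => ht.1 (hVU hV)⟩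
  obtain ⟨w, hwK, hw⟩ := hKc.exists_mapClusterPt_of_frequently hfreqK
  have hconst : ∀ s, 0 ≤ s →
      P.hamiltonian N (drivenFlow (P.langevinDrift N) w 0 s) = P.hamiltonian N w :=
    fun s hs => hP.hamiltonian_freeFlow_eq_of_mapClusterPt N x hw hs
  have hlast := hP.momentum_eq_zero_of_hamiltonian_const N hγ w hconst ⟨N - 1, by omega⟩
    (bathWeight_last_ne_zero N hN)
  have hw0 : w = 0 := hP.eq_zero_of_momentum_last_eq_zero N hN hVinj hcrit w hlast
  exact hwK.2 (hw0 ▸ h0V)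

/-! ### Pointed irreducibility of the transition kernels -/

/-- **Every neighbourhood of the equilibrium is reached with positive probability at all large
times**: for a uniformly confining site-dependent chain as in `tendsto_freeFlow_zero`, every initial
condition `z` and every neighbourhood `G` of `0` there is `s₀` with `P_t(z, G) > 0` for all `t ≥ s₀`
(`ConfinedReach.lean`). [cite: CuneoEckmannHairerReyBellet2018, Prop 3.3] -/
theorem langevinKernel_pos_of_mem_nhds_zero (hP : P.UniformlyConfining) (N : ℕ) (hγ : 0 < P.γ)
    (hN : 0 < N) (hVinj : ∀ i, Function.Injective (deriv (P.V i)))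
    (hcrit : ∀ q : Fin N → ℝ, (∀ i, P.dPotential N i q = 0) → q = 0) (T_L T_R : ℝ)
    (z : PhaseSpace N) {G : Set (PhaseSpace N)} (hG : G ∈ 𝓝 (0 : PhaseSpace N)) :
    ∃ s₀ : ℝ≥0, ∀ t : ℝ≥0, s₀ ≤ t → 0 < P.langevinKernel N T_L T_R t z G :=
  (hP.confinedDrift N).toConfinedDrift.sdeKernel_pos_of_tendsto_flow (hP.noiseVecL_mem_noise N T_L)
    (hP.noiseVecR_mem_noise N T_R) z (hP.tendsto_freeFlow_zero N hγ hN hVinj hcrit z) hG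

/-- **Pointed irreducibility** (`∃ t` form, the hypothesis `h_irred` of
`Literature/Probability/Process/SmallSets.lean`): every open set containing `0` is reached from
every point with positive probability. [cite: CuneoEckmannHairerReyBellet2018, Prop 3.3] -/
theorem exists_langevinKernel_pos_of_zero_mem (hP : P.UniformlyConfining) (N : ℕ) (hγ : 0 < P.γ)
    (hN : 0 < N) (hVinj : ∀ i, Function.Injective (deriv (P.V i)))
    (hcrit : ∀ q : Fin N → ℝ, (∀ i, P.dPotential N i q = 0) → q = 0) (T_L T_R : ℝ)
    (z : PhaseSpace N) (U : Set (PhaseSpace N)) (hU : IsOpen U) (h0 : (0 : PhaseSpace N) ∈ U) :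
    ∃ t : ℝ≥0, 0 < P.langevinKernel N T_L T_R t z U := by
  obtain ⟨s₀, hs₀⟩ := hP.langevinKernel_pos_of_mem_nhds_zero N hγ hN hVinj hcrit T_L T_R z
    (hU.mem_nhds h0)
  exact ⟨s₀, hs₀ s₀ le_rfl⟩

/-! ### Uniqueness of the invariant probability measure from one local minorisation -/

/-- **At most one invariant probability measure from ONE local minorisation near the
equilibrium.** For a uniformly confining site-dependent chain with `γ > 0`, `N ≥ 1`, all `V_i'`
injective, `0` the only critical point of the potential, and any bath temperatures: if the Langevin
kernels `P.langevinKernel N T_L T_R` admit a local small set at `0` — an open `G₀ ∋ 0`, a measure `ν₀`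
charging every neighbourhood of some point `y₀`, and a window `[t₀ - δ, t₀ + δ]` (`0 < δ ≤ t₀`) with
`P_t(w, ·) ≥ ν₀` for `w ∈ G₀` and `t` in the window — then at most one probability measure is
invariant under all of them. Proof: Feller + pointed irreducibility towards `0` make every compact set
small (`MarkovSemigroup.exists_smul_le_of_isCompact_of_mem`); the compact sublevel sets `{H ≤ n}`
exhaust phase space; `invariant_unique_of_small_cover` concludes.
[cite: CuneoEckmannHairerReyBellet2018, Prop 3.6 and Prop 3.8] -/
theorem invariant_unique_of_localSmall (hP : P.UniformlyConfining) (N : ℕ) (hγ : 0 < P.γ) (hN : 0 < N)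
    (hVinj : ∀ i, Function.Injective (deriv (P.V i)))
    (hcrit : ∀ q : Fin N → ℝ, (∀ i, P.dPotential N i q = 0) → q = 0) (T_L T_R : ℝ)
    {G₀ : Set (PhaseSpace N)} (hG₀ : IsOpen G₀) (h0 : (0 : PhaseSpace N) ∈ G₀)
    {ν₀ : Measure (PhaseSpace N)} {y₀ : PhaseSpace N}
    (hy₀ : ∀ V : Set (PhaseSpace N), IsOpen V → y₀ ∈ V → 0 < ν₀ V)
    {t₀ δ : ℝ} (hδ : 0 < δ) (hδt : δ ≤ t₀)
    (hloc : ∀ t : ℝ≥0, t₀ - δ ≤ (t : ℝ) → (t : ℝ) ≤ t₀ + δ → ∀ w ∈ G₀,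
      ν₀ ≤ P.langevinKernel N T_L T_R t w)
    {μ ν : Measure (PhaseSpace N)} [IsProbabilityMeasure μ] [IsProbabilityMeasure ν]
    (hμ : ∀ t : ℝ≥0, Kernel.Invariant (P.langevinKernel N T_L T_R t) μ)
    (hν : ∀ t : ℝ≥0, Kernel.Invariant (P.langevinKernel N T_L T_R t) ν) : μ = ν := by
  set κ := P.langevinKernel N T_L T_R with hκ
  haveI : ∀ t, IsMarkovKernel (κ t) := fun t => hP.isMarkovKernel_langevinKernel N T_L T_R t
  have h_add : ∀ s t : ℝ≥0, κ (s + t) = κ t ∘ₖ κ s := hP.langevinKernel_add N T_L T_R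
  have h_feller : ∀ (t : ℝ≥0) (g : BoundedContinuousFunction (PhaseSpace N) ℝ),
      Continuous fun x => ∫ y, g y ∂(κ t x) := fun t g =>
    hP.continuous_integral_langevinKernel_bcf N T_L T_R t g
  have h_irred : ∀ (z : PhaseSpace N) (U : Set (PhaseSpace N)), IsOpen U → (0 : PhaseSpace N) ∈ U →
      ∃ t : ℝ≥0, 0 < κ t z U := fun z U hU hz =>
    hP.exists_langevinKernel_pos_of_zero_mem N hγ hN hVinj hcrit T_L T_R z U hU hz
  -- the small cover by energy sublevel sets
  set C : ℕ → Set (PhaseSpace N) := fun n => {x | P.hamiltonian N x ≤ n} with hC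
  have hCmono : Monotone C := fun m n hmn x hx => by
    have hx' : P.hamiltonian N x ≤ m := hx
    show P.hamiltonian N x ≤ n
    exact hx'.trans (by exact_mod_cast hmn)
  have hCcov : ⋃ n, C n = univ := by
    refine eq_univ_of_forall fun x => mem_iUnion.2 ⟨⌈P.hamiltonian N x⌉₊, ?_⟩
    show P.hamiltonian N x ≤ (⌈P.hamiltonian N x⌉₊ : ℕ)
    exact Nat.le_ceil _
  have hν₀ne : ν₀ univ ≠ 0 := (hy₀ univ isOpen_univ (mem_univ _)).ne'
  have hsmall : ∀ n, ∃ t : ℝ≥0, ∃ m : Measure (PhaseSpace N), m ≠ 0 ∧ ∀ x ∈ C n, m ≤ κ t x := by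
    intro n
    obtain ⟨t_C, ht_C⟩ := MarkovSemigroup.exists_smul_le_of_isCompact_of_mem κ h_add h_feller h_irred
      hG₀ h0 hy₀ hδ hδt hloc (hP.isCompact_setOf_hamiltonian_le N n)
    obtain ⟨ε, hε0, -, hε⟩ := ht_C t_C le_rfl
    refine ⟨t_C, ε • ν₀, fun h0m => ?_, hε⟩
    have : (ε • ν₀) univ = 0 := by rw [h0m]; rfl
    rw [Measure.smul_apply, smul_eq_mul, mul_eq_zero] at this
    exact this.elim (fun h => hε0.ne' h) hν₀ne
  exact invariant_unique_of_small_cover κ C hCmono hCcov hsmall hμ hν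

end UniformlyConfining

end SiteChain

end Literature.MathematicalPhysics.KineticTheory.HeatConduction
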